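/-
Copyright (c) 2026 the pub-hodgecm-mathlib formalisation cell (harness21).  Prover seat hodgecm-mathlib-K2E3-p12 (g2), Track B «K2-LIT» ∕ h413
(`stmt-HodgeConjecture-24833`), line `K2_E3_EllipticInputs`, unit U12 «Harish-Chandra characters»: the centre of `U_N(H)(L⁺_v)` is SCALAR at EVERY
finite place (split places included) — the algebraic input of every «central translation» step of rows 11 and 12.  2026-09-04.
-/
import Literature.NumberTheory.Automorphic.LocalUnitaryGroupCenter      -- ★ `forall_mem_center_cmLocal_eq_scalar` (non-split places: centre = scalars, by reflections)
import Literature.NumberTheory.Automorphic.UnitaryGroupSplitPlace        -- ★ `localSplitEquiv` (`U_N(H)(L⁺_v) ≃ₜ* GL_N(L_w)` at a place moved by conjugation)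
import Literature.NumberTheory.Automorphic.UnitaryGroupNonsplitPlace     -- ★ `PlacesOver.subsingleton_of_smul_eq`
import Literature.NumberTheory.Automorphic.AdelicUnitaryGroupDatum       -- ★ `cmDatum` (`(cmDatum L N H).Local v = «local» L c̄ N H v`, rfl)
import Mathlib.LinearAlgebra.Matrix.GeneralLinearGroup.Basic             -- Mathlib `GeneralLinearGroup.mem_center_iff_val_mem_range_scalar`
import HarnessLib

/-!
# K2_E3 road (h413 = stmt-HodgeConjecture-24833), unit U12 — THE CENTRE OF `U_N(H)(L⁺_v)` IS SCALAR AT EVERY FINITE PLACE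

Cell `pub/hodgecm-mathlib` (D-0151), Track B (21-frontier RULING «PUSH BOTH» 2026-09-03, director req624), seat K2E3-p12 (g2), line lead of row 12.
`--supports stmt-HodgeConjecture-24833 --as helper`; THEOREMS ONLY (no definition ∕ instance ∕ notation ∕ named fact ∕ `sorry`); never imports `Cruxes/…/Lines`.

For a CM field `L` (complex conjugation `c`), a hermitian `H ∈ M_N(L)` with `det H ≠ 0` and a finite place `v` of `L⁺`, the local unitary group
`G = U_N(H)(L⁺_v) = (cmDatum L N H).Local v ≤ GL_N(Π_{w∣v} L_w)`:

* **`exists_val_eq_smul_one_of_mem_center`** — every `z ∈ Z(G)` has matrix `a • 1_N` for a unit `a ∈ (Π_{w∣v} L_w)ˣ`.  At a NON-SPLIT `v` (every `w ∣ v`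
  fixed by `c`) this is ★ `forall_mem_center_cmLocal_eq_scalar` (reflections along anisotropic vectors).  At a SPLIT `v` every place `w ∣ v` is MOVED by `c`
  (a fixed place would be the only one, ★ `PlacesOver.subsingleton_of_smul_eq`), and for each such `w` the projection ★ `localSplitEquiv` is a group isomorphism
  `G ≃ GL_N(L_w)` carrying `z` to a central, hence scalar, element of `GL_N(L_w)` (Mathlib `GeneralLinearGroup.mem_center_iff_val_mem_range_scalar`,
  transvections); so EVERY component `z_w` is scalar and the components reassemble to `a • 1_N` over `Π_w L_w` — no relation between the two components is needed.
* `mem_center_of_val_eq_smul_one` — conversely a scalar element is central (trivial); `isRegularElt_smul_iff`-type consequences are left to the users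
  (★ `K2E3CharpolyDiscrSmul.unitRel_smul_iff`).

USE (rows 11∕12, HC1999 Thm. 16.1∕16.3 at a CENTRAL point): the central-translation steps (★ `K2E3CharLocIntNearSemisimpleTwoOfIdentity` §3, K2E3-p11;
`K2E3NormalizedCharBddNearSemisimpleTwoOfIdentity`, this seat) read the weight `u·det(g)^{N−1} = disc χ_g` and regularity through the matrix `a • g`.
[PlatonovRapinchuk1994, §2.3 (centre of a unitary group = norm-one scalars)] [Dieudonne1971GroupesClassiques, Chap. II §5] [Rogawski1990, §12.2 p. 173].
HONEST LABEL: HC_CM is proved only modulo the 7 printed citations (2 remaining named inputs: hLiu418 = stmt-HodgeConjecture-24832, h413 =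
stmt-HodgeConjecture-24833) until rung 0 closes; this leaf retires nothing by itself.

## References
* [PlatonovRapinchuk1994] V. Platonov, A. Rapinchuk, *Algebraic Groups and Number Theory* (1994), §2.3.
* [Dieudonne1971GroupesClassiques] J. Dieudonné, *La géométrie des groupes classiques*, 3e éd. (1971), Chap. II §5.
* [Rogawski1990] J. Rogawski, *Automorphic Representations of Unitary Groups in Three Variables*, Annals of Math. Studies 123 (1990), §12.2 p. 173.
-/

set_option autoImplicit false
set_option linter.dupNamespace false   -- `Summit.HodgeConjecture.HodgeConjecture.…` (D-0017 nested layout; lakefile exemption for Summits)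

noncomputable section

open NumberField IsDedekindDomain
open scoped Matrix MatrixGroups
open Literature.NumberTheory.Automorphic Literature.NumberTheory.Automorphic.UnitaryGroup

namespace Summit.HodgeConjecture.HodgeConjecture.Cruxes.H413.K2E3LocalUnitaryCenterScalar

variable (L : Type) [Field L] [NumberField L] [IsCMField L] (N : ℕ) (H : Matrix (Fin N) (Fin N) L)
  (v : HeightOneSpectrum (𝓞 ↥(maximalRealSubfield L)))

/-- **A scalar element of `U_N(H)(L⁺_v)` is central** (its matrix `a • 1` commutes with every matrix). [folklore] -/
theorem mem_center_of_val_eq_smul_one {z : (UnitaryGroup.cmDatum L N H).Local v} {a : UnitaryGroup.LocalRing L v}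
    (hz : ((z.val : GL (Fin N) (UnitaryGroup.LocalRing L v)).val : Matrix (Fin N) (Fin N) (UnitaryGroup.LocalRing L v)) = a • (1 : Matrix (Fin N) (Fin N) (UnitaryGroup.LocalRing L v))) :
    z ∈ Subgroup.center ((UnitaryGroup.cmDatum L N H).Local v) := by
  rw [Subgroup.mem_center_iff]
  intro g
  apply Subtype.ext
  change (g.val : GL (Fin N) (UnitaryGroup.LocalRing L v)) * z.val = z.val * g.val
  ext1
  rw [Units.val_mul, Units.val_mul, hz, mul_smul_comm, smul_mul_assoc, mul_one, one_mul]

set_option maxHeartbeats 800000 in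
/-- **At a place `w ∣ v` MOVED by complex conjugation, the `w`-component of a central `z ∈ U_N(H)(L⁺_v)` is a scalar matrix** (`H` hermitian, `det H ≠ 0`):
the projection ★ `localSplitEquiv` is a group isomorphism `U_N(H)(L⁺_v) ≃ GL_N(L_w)`, so the image of `z` is central in `GL_N(L_w)`, hence scalar
(Mathlib `GeneralLinearGroup.mem_center_iff_val_mem_range_scalar`). [cite: PlatonovRapinchuk1994, §2.3] [cite: Rogawski1990, §12.2 p. 173] -/
theorem exists_map_eval_eq_smul_one_of_mem_center_of_ne (hH : (H.map (cmConjRingHom L))ᵀ = H) (hHd : H.det ≠ 0)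
    {z : (UnitaryGroup.cmDatum L N H).Local v} (hz : z ∈ Subgroup.center ((UnitaryGroup.cmDatum L N H).Local v))
    (w : UnitaryGroup.PlacesOver L v) (hw : IsCMField.complexConj L • w.1 ≠ w.1) :
    ∃ a : w.1.adicCompletion L,
      ((z.val : GL (Fin N) (UnitaryGroup.LocalRing L v)).val : Matrix (Fin N) (Fin N) (UnitaryGroup.LocalRing L v)).map
        (Pi.evalRingHom (fun w' : UnitaryGroup.PlacesOver L v => w'.1.adicCompletion L) w) = a • (1 : Matrix (Fin N) (Fin N) (w.1.adicCompletion L)) := by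
  have hc : IsCMField.complexConj L ≠ 1 := IsCMField.complexConj_ne_one L
  have hJw : IsUnit (UnitaryGroup.placeForm H w.1) :=
    UnitaryGroup.isUnit_placeForm H ((Matrix.isUnit_iff_isUnit_det H).2 (isUnit_iff_ne_zero.2 hHd)) w.1
  set e := UnitaryGroup.localSplitEquiv (IsCMField.complexConj L) H hc hH w hw hJw with he
  have hemat : ((e z : GL (Fin N) (w.1.adicCompletion L)) : Matrix (Fin N) (Fin N) (w.1.adicCompletion L)) =
      ((z.val : GL (Fin N) (UnitaryGroup.LocalRing L v)) : Matrix (Fin N) (Fin N) (UnitaryGroup.LocalRing L v)).map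
        (Pi.evalRingHom (fun w' : UnitaryGroup.PlacesOver L v => w'.1.adicCompletion L) w) := by
    rw [he, UnitaryGroup.localSplitEquiv, ContinuousMulEquiv.trans_apply, UnitaryGroup.localPiSplitEquiv_apply,
      UnitaryGroup.coe_localPiEquiv_symm_apply, GLn.coe_piEquiv_apply]
  -- `e z` is central in `GL_N(L_w)`
  have hcen : e z ∈ Subgroup.center (GL (Fin N) (w.1.adicCompletion L)) := by
    rw [Subgroup.mem_center_iff]
    intro g'
    obtain ⟨g, rfl⟩ := e.surjective g'
    rw [← map_mul, ← map_mul]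
    exact congrArg e (Subgroup.mem_center_iff.1 hz g)
  obtain ⟨a, ha⟩ := Matrix.GeneralLinearGroup.mem_center_iff_val_mem_range_scalar.1 hcen
  refine ⟨a, ?_⟩
  rw [← hemat, ← ha, Matrix.scalar_apply, Matrix.smul_one_eq_diagonal]

set_option maxHeartbeats 800000 in
/-- **THE CENTRE OF `U_N(H)(L⁺_v)` IS SCALAR, AT EVERY FINITE PLACE** (`H` hermitian, `det H ≠ 0`): every central `z` has matrix `a • 1_N` with
`a ∈ (Π_{w∣v} L_w)ˣ`.  Non-split `v`: ★ `forall_mem_center_cmLocal_eq_scalar`.  Split `v`: every `w ∣ v` is moved by `c` (★ `PlacesOver.subsingleton_of_smul_eq`),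
each component `z_w` is scalar (`exists_map_eval_eq_smul_one_of_mem_center_of_ne`), and the components reassemble; `a` is a unit because `z` is invertible
(`det z_w = a_w^N`; for `N = 0` take `a = 1`). [cite: PlatonovRapinchuk1994, §2.3] [cite: Dieudonne1971GroupesClassiques, Chap. II §5] [cite: Rogawski1990, §12.2 p. 173] -/
theorem exists_val_eq_smul_one_of_mem_center (hH : (H.map (cmConjRingHom L))ᵀ = H) (hHd : H.det ≠ 0)
    {z : (UnitaryGroup.cmDatum L N H).Local v} (hz : z ∈ Subgroup.center ((UnitaryGroup.cmDatum L N H).Local v)) :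
    ∃ a : (UnitaryGroup.LocalRing L v)ˣ,
      ((z.val : GL (Fin N) (UnitaryGroup.LocalRing L v)).val : Matrix (Fin N) (Fin N) (UnitaryGroup.LocalRing L v)) =
        (a : UnitaryGroup.LocalRing L v) • (1 : Matrix (Fin N) (Fin N) (UnitaryGroup.LocalRing L v)) := by
  have hc : IsCMField.complexConj L ≠ 1 := IsCMField.complexConj_ne_one L
  by_cases hns : ∀ w : UnitaryGroup.PlacesOver L v, IsCMField.complexConj L • w.1 = w.1
  · -- non-split: the reflection argument over the field `Π_w L_w = L_{w₀}`
    obtain ⟨u, hu⟩ := UnitaryGroup.forall_mem_center_cmLocal_eq_scalar L H hH (isUnit_iff_ne_zero.2 hHd) v hns z hz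
    refine ⟨u, ?_⟩
    have hu' : (z.val : GL (Fin N) (UnitaryGroup.LocalRing L v)) = Matrix.GeneralLinearGroup.scalar (Fin N) u := hu
    rw [hu', Matrix.GeneralLinearGroup.coe_scalar, Matrix.scalar_apply, Matrix.smul_one_eq_diagonal]
  · -- split: every place above `v` is moved by `c`
    push Not at hns
    obtain ⟨w₀, hw₀⟩ := hns
    have hmoved : ∀ w : UnitaryGroup.PlacesOver L v, IsCMField.complexConj L • w.1 ≠ w.1 := by
      intro w hw
      haveI := UnitaryGroup.PlacesOver.subsingleton_of_smul_eq (IsCMField.complexConj L) hc w hw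
      have hww : w₀ = w := Subsingleton.elim w₀ w
      rw [hww] at hw₀
      exact hw₀ hw
    -- componentwise scalars
    have hcomp := fun w => exists_map_eval_eq_smul_one_of_mem_center_of_ne L N H v hH hHd hz w (hmoved w)
    choose a ha using hcomp
    -- reassemble the matrix
    set A : UnitaryGroup.LocalRing L v := fun w => a w with hA
    have hmat : ((z.val : GL (Fin N) (UnitaryGroup.LocalRing L v)).val : Matrix (Fin N) (Fin N) (UnitaryGroup.LocalRing L v)) =
        A • (1 : Matrix (Fin N) (Fin N) (UnitaryGroup.LocalRing L v)) := by
      refine Matrix.ext fun i j => funext fun w => ?_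
      have e := congr_fun (congr_fun (ha w) i) j
      rw [Matrix.map_apply, Pi.evalRingHom_apply] at e
      rw [e, Matrix.smul_apply, Matrix.smul_apply, Matrix.one_apply, Matrix.one_apply]
      split_ifs <;> simp [hA]
    -- `A` is a unit: each component `a w` is (for `N = 0` the matrix ring is trivial and `a := 1` works)
    rcases Nat.eq_zero_or_pos N with hN | hN
    · subst hN
      exact ⟨1, Matrix.ext fun i _ => Fin.elim0 i⟩
    · have hAu : IsUnit A := by
        rw [Pi.isUnit_iff]
        intro w
        -- `det z_w = (a w)^N` is a unit
        have hdet : IsUnit (((z.val : GL (Fin N) (UnitaryGroup.LocalRing L v)).val : Matrix (Fin N) (Fin N) (UnitaryGroup.LocalRing L v)).map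
            (Pi.evalRingHom (fun w' : UnitaryGroup.PlacesOver L v => w'.1.adicCompletion L) w)).det := by
          have h := ((Matrix.isUnit_iff_isUnit_det _).1 (Units.isUnit (z.val : GL (Fin N) (UnitaryGroup.LocalRing L v)))).map
            (Pi.evalRingHom (fun w' : UnitaryGroup.PlacesOver L v => w'.1.adicCompletion L) w)
          rwa [RingHom.map_det, RingHom.mapMatrix_apply] at h
        rw [ha w, Matrix.det_smul, Matrix.det_one, mul_one, Fintype.card_fin] at hdet
        exact (isUnit_pow_iff hN.ne').1 hdet
      exact ⟨hAu.unit, by rw [hAu.unit_spec]; exact hmat⟩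

end Summit.HodgeConjecture.HodgeConjecture.Cruxes.H413.K2E3LocalUnitaryCenterScalar

end
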